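import Literature.NumberTheory.EllipticCurves.ImaginaryPeriod
import Literature.NumberTheory.EllipticCurves.ComplexMultiplicationBurungaleFlachProofs
import Mathlib.NumberTheory.GaussSum
import Mathlib.NumberTheory.DirichletCharacter.Basic
import Mathlib.NumberTheory.LSeries.Basic
import Literature.NumberTheory.EllipticCurves.LFunctionSmulProofs
import Literature.NumberTheory.EllipticCurves.ComplexPeriodProofs
import Literature.NumberTheory.EllipticCurves.BSDInvariantsProofs
import Literature.NumberTheory.EllipticCurves.ComplexMultiplicationDeuringRamified1728Proofs
import Literature.NumberTheory.EllipticCurves.OrdinaryPrimesProofs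
import Literature.NumberTheory.EllipticCurves.KramerTwoDescentLocal
import Summits.BirchSwinnertonDyer.Rank1Residual.X12.J1728TamagawaThree
import HarnessLib

/-!
# The quartic MODEL entry of `stub_neronIntegralThreeQuartic`: the `f`-free twisted-value statements transport along
# `C • V = (y² = x³ + Ax)` with `3 ∤ den u`, and every globally minimal `V` with `j = 1728` bad at `3` has such a model

Summit `BirchSwinnertonDyer`, crux `InertBadAtThree` (stmt-BirchSwinnertonDyer-19225), line of record
`Cruxes/InertBadAtThree/Lines/rubin_e1_inert_three.lean` v4 (lead `bsd-line-ibd-p1` g6), registered stub `stub_neronIntegralThreeQuartic`.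
Width seat bsd-wall-cm-bed-w3 g8 (`--supports 19225`, helper). Sequel of `…InertBadAtThreeQuarticValueExit` (p627747): there the stub was
reduced to the `f`-FREE Néron `3`-integrality of `τ(χ)·L(1)/Ω^±(V)` for an entire continuation `L` of `Σ χ̄(n)a_n(V)n⁻ˢ`. Input F1c of
the memo `Cruxes/InertBadAtThree/EPSILON-RESOLVED-bsd-idea-18-g7.md` §8 («`V` glob. minimal, `j = 1728`, bad at `3` ⇒ `V ≅ E_D`, `3 ∣ D`»)
is made kernel-exact here, in the form the CM road needs:

* `imaginaryPeriodRat_smul` — `Ω⁻(C • W) = |u|·Ω⁻(W)` over `ℚ` (imaginary twin of the tree's `realPeriodRat_smul_holds`; from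
  `Ω⁺·Ω⁻ = complexPeriod` and `complexPeriod_smul_holds`).
* `LValueEven_of_smul` / `LValueOdd_of_smul` — the two `f`-free statements of the value exit TRANSPORT from the model `C • V` to `V`
  whenever `p ∤ den(u_C)` (`a_n(C • V) = a_n(V)` by `LFunction_smul`; `Ω^±(C • V) = |u|·Ω^±(V)`; `s ↦ s·den u`; tree
  `KramerTwoDescent.not_dvd_den_of_padicValRat_eq_zero`, `X12.smul_quartic_scale` reused).
* `exists_smul_eq_quartic_padicValRat_u_eq_zero` — every globally minimal `V` with `j(V) = 1728` bad at `3` has a model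
  `C • V = ⟨0, 0, 0, A, 0⟩ = (y² = x³ + Ax)`, `A ∈ ℤ`, `3 ∣ A`, with `v₃(u_C) = 0` (hence `3 ∤ den u_C`): the tree's normal form
  `exists_variableChange_eq_of_j_eq_1728` rescaled by the power of `3` that kills `v₃(u)`; integrality of the new `A` from
  `Δ(y² = x³ + Ax) = −64A³ = u⁻¹²·Δ_min(V)` and `3 ∣ Δ_min(V)` (`hasGoodReductionAtPrime_of_not_dvd`).
* `LValueOdd_of_quarticModel` / `LValueEven_of_quarticModel` — the assembly: the `f`-free statement for `V` follows from the same
  statement for ITS quartic model `⟨0, 0, 0, A, 0⟩` (own `a_n`, own Néron-type periods of that model).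

HONEST FRAMING: no `L`-value is computed here; nothing proves the stub, the crux or BSD. No definition, no named fact, no `sorry`.
-/

set_option autoImplicit false
set_option linter.dupNamespace false

noncomputable section

open scoped BigOperators
open Complex WeierstrassCurve
open Literature.NumberTheory.EllipticCurves
open Summit.BirchSwinnertonDyer.Rank1Residual

namespace Summit.BirchSwinnertonDyer.BirchSwinnertonDyer.Theorems.InertBadSignedBranchesInertBadAtThreeQuarticModel

/-! ## §1 `Ω⁻(C • W) = |u|·Ω⁻(W)` -/

section Periods

variable (W : WeierstrassCurve ℚ) [W.IsElliptic] (C : VariableChange ℚ)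

/-- **The imaginary period scales by `|u|`**: `Ω⁻(C • W) = |u|·Ω⁻(W)` for every admissible change of variables over `ℚ`
(the period lattice of `C • W` is `u·Λ`; from `Ω⁺(C • W) = |u|Ω⁺(W)`, `Ω⁺Ω⁻ = complexPeriod` and `complexPeriod(C • W) = |u|²·complexPeriod`).
[cite: SilvermanAEC2009, III.1 Table 3.1] [cite: Pal2012, p. 1514] -/
theorem imaginaryPeriodRat_smul :
    (C • W).imaginaryPeriodRat = |((C.u : ℚ) : ℝ)| * W.imaginaryPeriodRat := by
  have h1 := (C • W).realPeriodRat_mul_imaginaryPeriodRat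
  have h2 := W.realPeriodRat_mul_imaginaryPeriodRat
  have hmap : ((C • W).baseChange ℝ).map (algebraMap ℝ ℂ) =
      ((C.map (algebraMap ℚ ℝ)).map (algebraMap ℝ ℂ)) • ((W.baseChange ℝ).map (algebraMap ℝ ℂ)) := by
    simp only [baseChange, ← map_variableChange]
  haveI : ((W.baseChange ℝ).map (algebraMap ℝ ℂ)).IsElliptic := by rw [baseChange]; infer_instance
  have h3 := ((W.baseChange ℝ).map (algebraMap ℝ ℂ)).complexPeriod_smul_holds
    ((C.map (algebraMap ℚ ℝ)).map (algebraMap ℝ ℂ))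
  rw [← hmap] at h3
  have hu : ‖((((C.map (algebraMap ℚ ℝ)).map (algebraMap ℝ ℂ)).u : ℂˣ) : ℂ)‖ = |((C.u : ℚ) : ℝ)| := by
    simp [VariableChange.map]
  rw [hu] at h3
  rw [h3, ← h2, W.realPeriodRat_smul_holds C] at h1
  -- `h1 : |u| Ω⁺ · Ω⁻(C•W) = |u|² · (Ω⁺ · Ω⁻)`
  have hΩ : 0 < W.realPeriodRat := W.realPeriodRat_pos_holds
  have hu0 : 0 < |((C.u : ℚ) : ℝ)| := by
    rw [abs_pos]; exact_mod_cast C.u.ne_zero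
  have hne : |((C.u : ℚ) : ℝ)| * W.realPeriodRat ≠ 0 := (mul_pos hu0 hΩ).ne'
  apply mul_left_cancel₀ hne
  rw [h1]; ring

end Periods

/-! ## §2 Transport of the `f`-free twisted-value statements along `C • V` -/

section Transport

variable {p : ℕ} [Fact p.Prime] {m : ℕ} [NeZero m]

variable (V : WeierstrassCurve ℚ) [V.IsElliptic] (C : VariableChange ℚ)

/-- `|u|·den u = |num u|` in `ℂ`. [folklore] -/
theorem abs_u_mul_den (u : ℚ) : ((|(u : ℝ)| : ℝ) : ℂ) * (u.den : ℂ) = ((u.num.natAbs : ℕ) : ℂ) := by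
  have h : |(u : ℝ)| * (u.den : ℝ) = (u.num.natAbs : ℝ) := by
    have hq : (u : ℝ) = (u.num : ℝ) / (u.den : ℝ) := by
      rw [← Rat.cast_intCast, ← Rat.cast_natCast, ← Rat.cast_div, Rat.num_div_den]
    have hden : (0 : ℝ) < u.den := by exact_mod_cast u.den_pos
    rw [hq, abs_div, abs_of_pos hden, div_mul_cancel₀ _ hden.ne', Nat.cast_natAbs, Int.cast_abs]
  exact_mod_cast congrArg (fun x : ℝ ↦ (x : ℂ)) h

/-- ★ **Transport, ODD branch.** If `p ∤ den(u_C)` and the `f`-free odd statement holds for the MODEL `C • V` (an entire `L` continuing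
`Σ χ̄(n)a_n(C • V)n⁻ˢ` with `s·τ(χ)·L(1)/(i·Ω⁻(C • V)) ∈ ℤ̄`, `p ∤ s`), then it holds for `V` (same `L`, `s ↦ s·den u_C`):
`a_n(C • V) = a_n(V)` (`LFunction_smul`) and `Ω⁻(C • V) = |u|·Ω⁻(V)`. [cite: SilvermanAEC2009, III.1 Table 3.1 and App. C §16] -/
theorem LValueOdd_of_smul (hu : ¬ p ∣ ((C.u : ℚ)).den) (χ : DirichletCharacter ℂ m)
    (h : ∃ L : ℂ → ℂ, Differentiable ℂ L ∧
      (∀ s : ℂ, 2 < s.re → L s = LSeries (fun n : ℕ ↦ χ⁻¹ (n : ZMod m) * ((C • V).LFunction n : ℂ)) s) ∧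
      ∃ s : ℕ, ¬ p ∣ s ∧ IsIntegral ℤ ((s : ℂ) *
        (gaussSum χ (ZMod.stdAddChar (N := m)) * L 1 / (Complex.I * ((C • V).imaginaryPeriodRat : ℂ))))) :
    ∃ L : ℂ → ℂ, Differentiable ℂ L ∧
      (∀ s : ℂ, 2 < s.re → L s = LSeries (fun n : ℕ ↦ χ⁻¹ (n : ZMod m) * (V.LFunction n : ℂ)) s) ∧
      ∃ s : ℕ, ¬ p ∣ s ∧ IsIntegral ℤ ((s : ℂ) *
        (gaussSum χ (ZMod.stdAddChar (N := m)) * L 1 / (Complex.I * (V.imaginaryPeriodRat : ℂ)))) := by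
  obtain ⟨L, hLd, hLs, s, hps, hint⟩ := h
  have hp := (Fact.out : p.Prime)
  refine ⟨L, hLd, fun z hz ↦ by rw [hLs z hz, LFunction_smul], s * (C.u : ℚ).den, ?_, ?_⟩
  · intro hdvd
    rcases (Nat.Prime.dvd_mul hp).mp hdvd with h | h
    · exact hps h
    · exact hu h
  · rw [imaginaryPeriodRat_smul V C] at hint
    have hΩ0 : (V.imaginaryPeriodRat : ℂ) ≠ 0 := by exact_mod_cast (V.imaginaryPeriodRat_pos).ne'
    have hu0 : ((|((C.u : ℚ) : ℝ)| : ℝ) : ℂ) ≠ 0 := by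
      have : (0 : ℝ) < |((C.u : ℚ) : ℝ)| := by rw [abs_pos]; exact_mod_cast C.u.ne_zero
      exact_mod_cast this.ne'
    have hnint : IsIntegral ℤ (((C.u : ℚ).num.natAbs : ℕ) : ℂ) := by
      simpa using isIntegral_algebraMap (R := ℤ) (A := ℂ) (x := (((C.u : ℚ).num.natAbs : ℕ) : ℤ))
    have key : ((s * (C.u : ℚ).den : ℕ) : ℂ) *
        (gaussSum χ (ZMod.stdAddChar (N := m)) * L 1 / (Complex.I * (V.imaginaryPeriodRat : ℂ))) =
        (((C.u : ℚ).num.natAbs : ℕ) : ℂ) * ((s : ℂ) * (gaussSum χ (ZMod.stdAddChar (N := m)) * L 1 /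
          (Complex.I * (((|((C.u : ℚ) : ℝ)| * V.imaginaryPeriodRat : ℝ) : ℂ))))) := by
      rw [← abs_u_mul_den]
      push_cast
      field_simp
    rw [key]
    exact hnint.mul hint

/-- ★ **Transport, EVEN branch** (`Ω⁺(C • V) = |u|·Ω⁺(V)`, tree `realPeriodRat_smul_holds`).
[cite: SilvermanAEC2009, III.1 Table 3.1 and App. C §16] -/
theorem LValueEven_of_smul (hu : ¬ p ∣ ((C.u : ℚ)).den) (χ : DirichletCharacter ℂ m)
    (h : ∃ L : ℂ → ℂ, Differentiable ℂ L ∧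
      (∀ s : ℂ, 2 < s.re → L s = LSeries (fun n : ℕ ↦ χ⁻¹ (n : ZMod m) * ((C • V).LFunction n : ℂ)) s) ∧
      ∃ s : ℕ, ¬ p ∣ s ∧ IsIntegral ℤ ((s : ℂ) *
        (gaussSum χ (ZMod.stdAddChar (N := m)) * L 1 / ((C • V).realPeriodRat : ℂ)))) :
    ∃ L : ℂ → ℂ, Differentiable ℂ L ∧
      (∀ s : ℂ, 2 < s.re → L s = LSeries (fun n : ℕ ↦ χ⁻¹ (n : ZMod m) * (V.LFunction n : ℂ)) s) ∧
      ∃ s : ℕ, ¬ p ∣ s ∧ IsIntegral ℤ ((s : ℂ) *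
        (gaussSum χ (ZMod.stdAddChar (N := m)) * L 1 / (V.realPeriodRat : ℂ))) := by
  obtain ⟨L, hLd, hLs, s, hps, hint⟩ := h
  have hp := (Fact.out : p.Prime)
  refine ⟨L, hLd, fun z hz ↦ by rw [hLs z hz, LFunction_smul], s * (C.u : ℚ).den, ?_, ?_⟩
  · intro hdvd
    rcases (Nat.Prime.dvd_mul hp).mp hdvd with h | h
    · exact hps h
    · exact hu h
  · rw [V.realPeriodRat_smul_holds C] at hint
    have hΩ0 : (V.realPeriodRat : ℂ) ≠ 0 := by
      exact_mod_cast (V.realPeriodRat_pos_holds : 0 < V.realPeriodRat).ne'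
    have hu0 : ((|((C.u : ℚ) : ℝ)| : ℝ) : ℂ) ≠ 0 := by
      have : (0 : ℝ) < |((C.u : ℚ) : ℝ)| := by rw [abs_pos]; exact_mod_cast C.u.ne_zero
      exact_mod_cast this.ne'
    have hnint : IsIntegral ℤ (((C.u : ℚ).num.natAbs : ℕ) : ℂ) := by
      simpa using isIntegral_algebraMap (R := ℤ) (A := ℂ) (x := (((C.u : ℚ).num.natAbs : ℕ) : ℤ))
    have key : ((s * (C.u : ℚ).den : ℕ) : ℂ) *
        (gaussSum χ (ZMod.stdAddChar (N := m)) * L 1 / (V.realPeriodRat : ℂ)) =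
        (((C.u : ℚ).num.natAbs : ℕ) : ℂ) * ((s : ℂ) * (gaussSum χ (ZMod.stdAddChar (N := m)) * L 1 /
          (((|((C.u : ℚ) : ℝ)| * V.realPeriodRat : ℝ) : ℂ)))) := by
      rw [← abs_u_mul_den]
      push_cast
      field_simp
    rw [key]
    exact hnint.mul hint

end Transport

/-! ## §3 Every globally minimal `V` with `j = 1728` bad at `3` has a quartic model with `v₃(u) = 0` -/

section Model

/-- `Δ(y² = x³ + Bx) = −64B³`. [cite: SilvermanAEC2009, III.1] -/
theorem Δ_quartic (B : ℚ) : (⟨0, 0, 0, B, 0⟩ : WeierstrassCurve ℚ).Δ = -64 * B ^ 3 := by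
  simp only [WeierstrassCurve.Δ, WeierstrassCurve.b₂, WeierstrassCurve.b₄, WeierstrassCurve.b₆, WeierstrassCurve.b₈]
  ring

/-- `v₃(3^b / 3^a) = b − a`. [folklore] -/
theorem padicValRat_three_pow_div_pow (a b : ℕ) :
    padicValRat 3 ((3 : ℚ) ^ b / (3 : ℚ) ^ a) = (b : ℤ) - a := by
  haveI : Fact (Nat.Prime 3) := ⟨Nat.prime_three⟩
  have h3 : (3 : ℚ) ≠ 0 := by norm_num
  rw [padicValRat.div (pow_ne_zero _ h3) (pow_ne_zero _ h3), padicValRat.pow (3 : ℚ), padicValRat.pow (3 : ℚ)]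
  have hself : padicValRat 3 (3 : ℚ) = 1 := by
    have := padicValRat.self (p := 3) (by norm_num)
    exact_mod_cast this
  rw [hself]; ring

/-- ★ **The quartic model with `3`-adic unit scaling.** Every globally minimal elliptic `V/ℚ` with `j(V) = 1728` and bad reduction at `3`
is `ℚ`-isomorphic to `y² = x³ + Ax` with `A ∈ ℤ`, `3 ∣ A`, by a change of variables `C` with `v₃(u_C) = 0` (so the Néron-type periods of
the two models agree up to a rational factor prime to `3`, and `a_n` agree). Construction: the tree's normal form `C₀ • V = (y² = x³ + 2ʳA₀x)`
(`exists_variableChange_eq_of_j_eq_1728`, AEC X.5.4 (iii)) rescaled by `u = 3^{v₃(den u₀)}/3^{v₃(num u₀)}`; the new coefficient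
`A = 3^{4v₃(num u₀)}·2ʳA₀/3^{4v₃(den u₀)}` is an integer divisible by `3` because `−64·(2ʳA₀)³ = u₀⁻¹²·Δ_min(V)` and `3 ∣ Δ_min(V)`
(`hasGoodReductionAtPrime_of_not_dvd`), i.e. `v₃(A) = v₃(Δ_min(V))/3 ≥ 1`. [cite: SilvermanAEC2009, X.5.4 (iii) and VII.1 Remark 1.1] -/
theorem exists_smul_eq_quartic_padicValRat_u_eq_zero (V : WeierstrassCurve ℚ) [V.IsElliptic] [V.IsGloballyMinimal]
    (hj : V.j = 1728) (hbad : ¬ V.HasGoodReductionAtPrime 3) :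
    ∃ (A : ℤ) (C : VariableChange ℚ), C • V = ⟨0, 0, 0, (A : ℚ), 0⟩ ∧ (3 : ℤ) ∣ A ∧ padicValRat 3 (C.u : ℚ) = 0 := by
  haveI : Fact (Nat.Prime 3) := ⟨Nat.prime_three⟩
  obtain ⟨r, A₀, C₀, -, hodd, hC₀⟩ := exists_variableChange_eq_of_j_eq_1728 V hj
  have hA00 : A₀ ≠ 0 := by rintro rfl; exact absurd hodd (by decide)
  set Bz : ℤ := 2 ^ r * A₀ with hBz
  have hBz0 : Bz ≠ 0 := mul_ne_zero (pow_ne_zero _ two_ne_zero) hA00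
  have hC₀' : C₀ • V = ⟨0, 0, 0, (Bz : ℚ), 0⟩ := by rw [hC₀, hBz]; push_cast; rfl
  -- the discriminant relation `-64 Bz³ = u₀⁻¹² Δ_min(V)`
  set u₀ : ℚ := (C₀.u : ℚ) with hu₀
  have hu₀0 : u₀ ≠ 0 := C₀.u.ne_zero
  have hΔmin : (minimalDiscriminantInt V : ℚ) = V.Δ := cast_minimalDiscriminantInt V
  have hΔ : u₀ ^ 12 * (-64 * (Bz : ℚ) ^ 3) = (minimalDiscriminantInt V : ℚ) := by
    have h := congrArg WeierstrassCurve.Δ hC₀'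
    rw [variableChange_Δ, Δ_quartic, ← hΔmin] at h
    rw [← h, Units.val_inv_eq_inv_val, ← hu₀]
    field_simp
  have hmin0 : minimalDiscriminantInt V ≠ 0 := minimalDiscriminantInt_ne_zero V
  have h3min : (3 : ℤ) ∣ minimalDiscriminantInt V := by
    by_contra h
    exact hbad (hasGoodReductionAtPrime_of_not_dvd V 3 h)
  -- valuations: `12 v(u₀) + 3 v(Bz) = v(Δ_min) ≥ 1`
  set a : ℕ := padicValInt 3 u₀.num with ha
  set b : ℕ := padicValNat 3 u₀.den with hb
  set n : ℕ := padicValInt 3 Bz with hn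
  set d : ℕ := padicValInt 3 (minimalDiscriminantInt V) with hd
  have hvu : padicValRat 3 u₀ = (a : ℤ) - b := by rw [padicValRat_def]
  have h64 : padicValRat 3 (-64 : ℚ) = 0 := by
    rw [padicValRat.neg, show (64 : ℚ) = ((64 : ℕ) : ℚ) by norm_num, padicValRat.of_nat]
    norm_num [padicValNat.eq_zero_of_not_dvd]
  have hval : 12 * ((a : ℤ) - b) + 3 * n = d := by
    have h := congrArg (padicValRat 3) hΔ
    rw [padicValRat.mul (pow_ne_zero _ hu₀0) (mul_ne_zero (by norm_num) (pow_ne_zero _ (by exact_mod_cast hBz0))),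
      padicValRat.pow u₀, padicValRat.mul (by norm_num) (pow_ne_zero _ (by exact_mod_cast hBz0)), h64,
      padicValRat.pow (Bz : ℚ), padicValRat.of_int, padicValRat.of_int, hvu] at h
    rw [hn, hd]
    push_cast at h ⊢
    linarith
  have hd1 : 1 ≤ d := by
    rw [hd]
    have := (padicValInt_dvd_iff (p := 3) 1 (minimalDiscriminantInt V)).mp (by simpa using h3min)
    rcases this with h | h
    · exact absurd h hmin0
    · exact h
  -- the rescaling `u = 3^b / 3^a`
  have h3 : (3 : ℚ) ≠ 0 := by norm_num
  set uS : ℚˣ := Units.mk0 ((3 : ℚ) ^ b / (3 : ℚ) ^ a) (div_ne_zero (pow_ne_zero _ h3) (pow_ne_zero _ h3)) with huS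
  set S : VariableChange ℚ := ⟨uS, 0, 0, 0⟩ with hS
  -- the new coefficient `A = 3^{4a} Bz / 3^{4b}` is an integer
  have hdvd : (3 : ℤ) ^ (4 * b) ∣ 3 ^ (4 * a) * Bz := by
    rcases le_or_gt b a with hab | hab
    · exact dvd_mul_of_dvd_left (pow_dvd_pow _ (by omega)) _
    · have hnb : 4 * b - 4 * a ≤ n := by
        have : (4 : ℤ) * b - 4 * a ≤ n := by linarith
        omega
      have hB : (3 : ℤ) ^ (4 * b - 4 * a) ∣ Bz := by
        have := (padicValInt_dvd_iff (p := 3) (4 * b - 4 * a) Bz).mpr (Or.inr (by rw [← hn]; exact hnb))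
        simpa using this
      have := mul_dvd_mul_left ((3 : ℤ) ^ (4 * a)) hB
      rwa [← pow_add, show 4 * a + (4 * b - 4 * a) = 4 * b by omega] at this
  set A : ℤ := 3 ^ (4 * a) * Bz / 3 ^ (4 * b) with hA
  have hAmul : A * 3 ^ (4 * b) = 3 ^ (4 * a) * Bz := Int.ediv_mul_cancel hdvd
  have hA0 : A ≠ 0 := by
    intro h; rw [h, zero_mul] at hAmul
    exact mul_ne_zero (pow_ne_zero _ (by norm_num)) hBz0 hAmul.symm
  have hAcast : (A : ℚ) = (3 : ℚ) ^ (4 * a) * Bz / (3 : ℚ) ^ (4 * b) := by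
    rw [hA, Int.cast_div hdvd (by exact_mod_cast pow_ne_zero _ (by norm_num : (3 : ℤ) ≠ 0))]
    push_cast; ring
  refine ⟨A, S * C₀, ?_, ?_, ?_⟩
  · -- the model
    rw [mul_smul, hC₀', hS, X12.smul_quartic_scale]
    congr 1
    rw [hAcast, huS]
    simp only [Units.val_inv_eq_inv_val, Units.val_mk0]
    field_simp
    ring
  · -- `3 ∣ A`: `v₃(A) = 4a + n − 4b ≥ 1`
    have hvA : (padicValInt 3 A : ℤ) + 4 * b = 4 * a + n := by
      have h := congrArg (fun z : ℤ ↦ (padicValInt 3 z : ℤ)) hAmul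
      rw [padicValInt.mul hA0 (pow_ne_zero _ (by norm_num)), padicValInt.mul (pow_ne_zero _ (by norm_num)) hBz0] at h
      have hp1 : padicValInt 3 ((3 : ℤ) ^ (4 * b)) = 4 * b := by
        rw [padicValInt, Int.natAbs_pow]; exact padicValNat.prime_pow _
      have hp2 : padicValInt 3 ((3 : ℤ) ^ (4 * a)) = 4 * a := by
        rw [padicValInt, Int.natAbs_pow]; exact padicValNat.prime_pow _
      rw [hp1, hp2, ← hn] at h
      push_cast at h
      linarith
    have h1 : 1 ≤ padicValInt 3 A := by omega
    have := (padicValInt_dvd_iff (p := 3) 1 A).mpr (Or.inr h1)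
    simpa using this
  · -- `v₃(u) = 0`
    show padicValRat 3 (((S * C₀).u : ℚˣ) : ℚ) = 0
    rw [VariableChange.mul_def]
    simp only [Units.val_mul]
    rw [padicValRat.mul uS.ne_zero hu₀0, huS, Units.val_mk0, padicValRat_three_pow_div_pow, hvu]
    ring

end Model

/-! ## §4 Assembly: the `f`-free statements for `V` from those of its quartic model -/

section Assembly

variable {m : ℕ} [NeZero m]

/-- ★ **ODD branch on the quartic model.** For a globally minimal `V` with `j(V) = 1728` bad at `3` and a character `χ` mod `m`: if for every
quartic MODEL `E_A = (y² = x³ + Ax)` of `V` (`A ∈ ℤ ∖ 0`, `3 ∣ A`, `C • V = E_A` for some `C`) the `f`-free odd statement holds for `E_A`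
— SOME entire `L` with `L(s) = Σ χ̄(n)a_n(E_A)n⁻ˢ` (`re s > 2`) and `∃ s, 3 ∤ s, s·τ(χ)·L(1)/(i·Ω⁻(E_A)) ∈ ℤ̄`, `Ω⁻(E_A)` the imaginary period
of THAT model — then it holds for `V` (`exists_smul_eq_quartic_padicValRat_u_eq_zero` + `LValueOdd_of_smul`). This is input F1c of memo
EPSILON-RESOLVED §8 in kernel form: the CM road may work on `y² = x³ + Ax` with its own `a_n` and period lattice.
[cite: SilvermanAEC2009, X.5.4 (iii) and III.1 Table 3.1] -/
theorem LValueOdd_of_quarticModel (V : WeierstrassCurve ℚ) [V.IsElliptic] [V.IsGloballyMinimal]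
    (hj : V.j = 1728) (hbad : ¬ V.HasGoodReductionAtPrime 3) (χ : DirichletCharacter ℂ m)
    (h : ∀ A : ℤ, A ≠ 0 → (3 : ℤ) ∣ A → (∃ C : VariableChange ℚ, C • V = ⟨0, 0, 0, (A : ℚ), 0⟩) →
      ∃ L : ℂ → ℂ, Differentiable ℂ L ∧
        (∀ s : ℂ, 2 < s.re → L s = LSeries (fun n : ℕ ↦ χ⁻¹ (n : ZMod m) *
          ((⟨0, 0, 0, (A : ℚ), 0⟩ : WeierstrassCurve ℚ).LFunction n : ℂ)) s) ∧
        ∃ s : ℕ, ¬ 3 ∣ s ∧ IsIntegral ℤ ((s : ℂ) * (gaussSum χ (ZMod.stdAddChar (N := m)) * L 1 /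
          (Complex.I * ((⟨0, 0, 0, (A : ℚ), 0⟩ : WeierstrassCurve ℚ).imaginaryPeriodRat : ℂ))))) :
    ∃ L : ℂ → ℂ, Differentiable ℂ L ∧
      (∀ s : ℂ, 2 < s.re → L s = LSeries (fun n : ℕ ↦ χ⁻¹ (n : ZMod m) * (V.LFunction n : ℂ)) s) ∧
      ∃ s : ℕ, ¬ 3 ∣ s ∧ IsIntegral ℤ ((s : ℂ) *
        (gaussSum χ (ZMod.stdAddChar (N := m)) * L 1 / (Complex.I * (V.imaginaryPeriodRat : ℂ)))) := by
  haveI : Fact (Nat.Prime 3) := ⟨Nat.prime_three⟩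
  obtain ⟨A, C, hCV, h3A, hu⟩ := exists_smul_eq_quartic_padicValRat_u_eq_zero V hj hbad
  have hA0 : A ≠ 0 := by
    intro hA
    have hΔ : (C • V).Δ ≠ 0 := (C • V).isUnit_Δ.ne_zero
    rw [hCV, Δ_quartic, hA] at hΔ
    norm_num at hΔ
  refine LValueOdd_of_smul (p := 3) V C (KramerTwoDescent.not_dvd_den_of_padicValRat_eq_zero hu) χ ?_
  rw [hCV]
  exact h A hA0 h3A ⟨C, hCV⟩

/-- ★ **EVEN branch on the quartic model** (`Ω⁺`, `realPeriodRat`). [cite: SilvermanAEC2009, X.5.4 (iii) and III.1 Table 3.1] -/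
theorem LValueEven_of_quarticModel (V : WeierstrassCurve ℚ) [V.IsElliptic] [V.IsGloballyMinimal]
    (hj : V.j = 1728) (hbad : ¬ V.HasGoodReductionAtPrime 3) (χ : DirichletCharacter ℂ m)
    (h : ∀ A : ℤ, A ≠ 0 → (3 : ℤ) ∣ A → (∃ C : VariableChange ℚ, C • V = ⟨0, 0, 0, (A : ℚ), 0⟩) →
      ∃ L : ℂ → ℂ, Differentiable ℂ L ∧
        (∀ s : ℂ, 2 < s.re → L s = LSeries (fun n : ℕ ↦ χ⁻¹ (n : ZMod m) *
          ((⟨0, 0, 0, (A : ℚ), 0⟩ : WeierstrassCurve ℚ).LFunction n : ℂ)) s) ∧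
        ∃ s : ℕ, ¬ 3 ∣ s ∧ IsIntegral ℤ ((s : ℂ) * (gaussSum χ (ZMod.stdAddChar (N := m)) * L 1 /
          ((⟨0, 0, 0, (A : ℚ), 0⟩ : WeierstrassCurve ℚ).realPeriodRat : ℂ)))) :
    ∃ L : ℂ → ℂ, Differentiable ℂ L ∧
      (∀ s : ℂ, 2 < s.re → L s = LSeries (fun n : ℕ ↦ χ⁻¹ (n : ZMod m) * (V.LFunction n : ℂ)) s) ∧
      ∃ s : ℕ, ¬ 3 ∣ s ∧ IsIntegral ℤ ((s : ℂ) *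
        (gaussSum χ (ZMod.stdAddChar (N := m)) * L 1 / (V.realPeriodRat : ℂ))) := by
  haveI : Fact (Nat.Prime 3) := ⟨Nat.prime_three⟩
  obtain ⟨A, C, hCV, h3A, hu⟩ := exists_smul_eq_quartic_padicValRat_u_eq_zero V hj hbad
  have hA0 : A ≠ 0 := by
    intro hA
    have hΔ : (C • V).Δ ≠ 0 := (C • V).isUnit_Δ.ne_zero
    rw [hCV, Δ_quartic, hA] at hΔ
    norm_num at hΔ
  refine LValueEven_of_smul (p := 3) V C (KramerTwoDescent.not_dvd_den_of_padicValRat_eq_zero hu) χ ?_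
  rw [hCV]
  exact h A hA0 h3A ⟨C, hCV⟩

end Assembly

end Summit.BirchSwinnertonDyer.BirchSwinnertonDyer.Theorems.InertBadSignedBranchesInertBadAtThreeQuarticModel

end
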